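import Literature.MathematicalPhysics.QuantumFieldTheory.Balaban1983to89.T4FlagMemory

/-!
# Spine/NE4/ScaleShiftBareCorner — given node U2's memory companion, NE4 need only hold AT VANISHING BARE COUPLING: the
# scale-shift bound checked at histories whose oldest (ultraviolet) coupling is arbitrarily small already gives
# `ScaleShiftRate` on the whole box, at the rate `max θ ω` (cell `pub-balaban-gaps`, seat ne4, generation 19; census item
# (R62) of `HOME/ne/NE4.md` §5, its corrected β-level half)

HONEST FRAMING.  Bookkeeping for rung (B)+1 on ONE FIXED finite four-torus — NOT ℝ⁴, NOT infinite volume, NOT a mass gap, NOT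
Clay.  NE4 = `T4CouplingMatching.ScaleShiftRate` is NOT PRINTED ([Balaban1987RG1] p. 264 «We will investigate other properties in
a separate paper») and NOT PROVED here; spine estimates proved 0∕9, unchanged.  Every hypothesis on `β` is an UNPRINTED input;
nothing of Bałaban's is instantiated or asserted.  0 `def`, 0 sorry.

WHAT.  Node U2 consumes the TRIPLE `ScaleShiftRate c θ γ β ∧ HistLipschitz Λ γ β ∧ FadingMemory C ω Λ`
(`T4CouplingMatching.disc_le_of_fadingMemory`).  The third member says the influence of the coupling `g_i` on `β_{k+1}` is
Lipschitz with constant `Λ k i ≤ C·ω^{k−i}` — for the OLDEST coupling `g_0` of a history of length `k+2` that is `C·ω^{k+1}`.  Hence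
in the scale-shift comparison `|β_{k+2}(g_0, g_1, …, g_{k+1}) − β_{k+1}(g_1, …, g_{k+1})|` the bare coupling `g_0` may be slid to any
other value in `]0,γ]` at the price `C·γ·ω^{k+1}`, the tail being untouched:

* §1 `scaleShiftRate_of_bareCorner` — IF for every `k`, every tail history `v ∈ ]0,γ]^{k+1}` and every `η > 0` there is SOME bare
  coupling `ε ∈ ]0,γ]` with `|β_{k+2}(ε, v) − β_{k+1}(v)| ≤ c·θ^k + η` (NE4 checked only where one pleases in the oldest variable — in
  particular only in the limit `g_0 → 0⁺`, the asymptotically free corner of the box), THEN `ScaleShiftRate (c + C·γ·ω) (max θ ω) γ β`.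
* §2 `bareCorner_of_scaleShiftRate` — the converse is immediate (take `ε = γ`), so modulo constants and the rate `max θ ω` the
  corner form IS NE4, given the memory companion.
* §3 `scaleShiftRate_of_bareRemnant` — the quantitative instance: a box bound `c·θ^k + R·g_0^κ` with ANY `κ > 0` (a «remnant sized
  by the bare coupling», the β-level form of `Spine/NE4/ScaleShiftRemnant.lean` §3) is no weakening of NE4 at all under the memory
  companion (re-derivation of `ScaleShiftRemnant.scaleShiftRate_of_bareRemnant_fadingMemory` from §1, with no ℓ¹ road imported).

WHAT THIS SAYS FOR THE ROW (census (R62), corrected β-level half).  The printed sibling law of [GawedzkiKupiainen1986] §5 (84),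
«geometric + a power of the bare coupling», concerns RUNS pinned at the ultraviolet end; for a β-function FAMILY on the box with
node U2's memory companion, a remnant sized by the bare coupling cannot occur — what a NODE-O typer owes for NE4 is the geometric
bound in the ASYMPTOTICALLY FREE CORNER `g_0 → 0⁺` of each box (every tail history, every `k`), nothing at moderate bare coupling.
`Spine/NE4/ScaleShiftRemnant.lean`'s ℓ¹ tolerance (§1–§2 there) remains the statement for CUTOFF-INDEXED remnants (run-length
dependent data, as in the printed sibling), which no `HBeta` on the box carries.  No status word moves: NE4 DEPENDENT
(⇐ NE5 ∧ (AF-0r)); NOT IN PRINT; NOT PROVED; 0∕9.  HONEST DEPENDENCY (cell, verbatim): continuum YM on T⁴ ⇐ BetaPertH ∧ nine spine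
estimates (0∕9 proved); BetaPertH ⇐ (D1) ∧ (D4) ∧ CAP+tail.

References (TYPES only): [Balaban1987RG1] = T. Bałaban, Commun. Math. Phys. **109** (1987) 249–301, (0.20) p. 256, p. 264, §5
p. 298; [GawedzkiKupiainen1986] = K. Gawędzki, A. Kupiainen, Commun. Math. Phys. **106** (1986) 533–550, §5 (84) p. 545.
-/

noncomputable section

open Finset

namespace Summit.QuantumFields.BalabanUV.T4Continuum.Spine.NE4.ScaleShiftBareCorner

open Literature.MathematicalPhysics.QuantumFieldTheory.Balaban1983to89
open Literature.MathematicalPhysics.QuantumFieldTheory.Balaban1983to89.FlowStep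
open T4CouplingMatching (ScaleShiftRate HistLipschitz FadingMemory)
open T4FlagMemory (tail_mem_box)

/-! ## §1 NE4 at the asymptotically free corner of the box suffices -/

/-- Prepending a bare coupling `ε ∈ ]0,γ]` to a history in `]0,γ]^{k+1}` gives a history in `]0,γ]^{k+2}`. [folklore] -/
theorem cons_mem_box {γ ε : ℝ} {k : ℕ} {v : Fin (k + 1) → ℝ} (hε0 : 0 < ε) (hεγ : ε ≤ γ) (hv : v ∈ Box γ k) :
    (Fin.cons ε v : Fin (k + 2) → ℝ) ∈ Box γ (k + 1) := by
  refine mem_box.mpr fun i => ?_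
  refine Fin.cases ?_ (fun j => ?_) i
  · simpa using And.intro hε0 hεγ
  · simpa using (mem_box.mp hv) j

/-- THE SLIDE IN THE OLDEST COORDINATE: under `HistLipschitz Λ γ β` with `FadingMemory C ω Λ`, two histories of length `k+2` in the
box with the SAME tail differ in `β_{k+2}` by at most `C·ω^{k+1}·γ`. [cite: Balaban1987RG1, §5 p.298] -/
theorem abs_sub_cons_le {β : HBeta} {γ C ω : ℝ} {Λ : ℕ → ℕ → ℝ} {k : ℕ} {w : Fin (k + 2) → ℝ} {ε : ℝ}
    (hL : HistLipschitz Λ γ β) (hΛ : FadingMemory C ω Λ) (hC : 0 ≤ C) (hω0 : 0 ≤ ω)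
    (hw : w ∈ Box γ (k + 1)) (hε0 : 0 < ε) (hεγ : ε ≤ γ) :
    |β (k + 1) w - β (k + 1) (Fin.cons ε (Fin.tail w))| ≤ C * γ * ω ^ (k + 1) := by
  have hwi := mem_box.mp hw
  have hw' : (Fin.cons ε (Fin.tail w) : Fin (k + 2) → ℝ) ∈ Box γ (k + 1) := cons_mem_box hε0 hεγ (tail_mem_box hw)
  have hLk := hL (k + 1) w (Fin.cons ε (Fin.tail w)) hw hw'
  have hsum : ∑ i : Fin (k + 2), Λ (k + 1) i * |w i - (Fin.cons ε (Fin.tail w) : Fin (k + 2) → ℝ) i|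
      = Λ (k + 1) 0 * |w 0 - ε| := by
    rw [Fin.sum_univ_succ]
    have hrest : ∑ i : Fin (k + 1), Λ (k + 1) i.succ * |w i.succ - (Fin.cons ε (Fin.tail w) : Fin (k + 2) → ℝ) i.succ| = 0 := by
      refine Finset.sum_eq_zero fun i _ => ?_
      rw [Fin.cons_succ, Fin.tail, sub_self, abs_zero, mul_zero]
    rw [hrest, add_zero, Fin.cons_zero]
    simp
  rw [hsum] at hLk
  have hΛ0 := hΛ (k + 1) 0 (Nat.zero_le _)
  have hdist : |w 0 - ε| ≤ γ := by
    rw [abs_sub_le_iff]; constructor <;> linarith [(hwi 0).1, (hwi 0).2]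
  calc |β (k + 1) w - β (k + 1) (Fin.cons ε (Fin.tail w))| ≤ Λ (k + 1) 0 * |w 0 - ε| := hLk
    _ ≤ C * ω ^ (k + 1 - 0) * γ := mul_le_mul hΛ0.2 hdist (abs_nonneg _) (by positivity)
    _ = C * γ * ω ^ (k + 1) := by rw [Nat.sub_zero]; ring

/-- **NE4 AT VANISHING BARE COUPLING SUFFICES.**  Suppose that for every scale `k`, every tail history `v ∈ ]0,γ]^{k+1}` and every
`η > 0` there is a bare coupling `ε ∈ ]0,γ]` with `|β_{k+2}(ε, v) − β_{k+1}(v)| ≤ c·θ^k + η` (so NE4 is checked only at bare couplings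
of one's choosing — e.g. only along `g_0 → 0⁺`), and node U2's memory companion holds: `HistLipschitz Λ γ β`, `FadingMemory C ω Λ`
(`C, ω ≥ 0`; `c, θ ≥ 0`, `γ > 0`).  Then NE4 holds on the whole box: `ScaleShiftRate (c + C·γ·ω) (max θ ω) γ β`.  Every hypothesis is
an UNPRINTED input. [cite: Balaban1987RG1, (0.20) p.256 and §5 p.298] -/
theorem scaleShiftRate_of_bareCorner {β : HBeta} {γ c θ C ω : ℝ} {Λ : ℕ → ℕ → ℝ}
    (hγ : 0 < γ) (hc : 0 ≤ c) (hθ0 : 0 ≤ θ) (hC : 0 ≤ C) (hω0 : 0 ≤ ω)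
    (hβ0 : ∀ k (v : Fin (k + 1) → ℝ), v ∈ Box γ k → ∀ η : ℝ, 0 < η →
      ∃ ε : ℝ, 0 < ε ∧ ε ≤ γ ∧ |β (k + 1) (Fin.cons ε v) - β k v| ≤ c * θ ^ k + η)
    (hL : HistLipschitz Λ γ β) (hΛ : FadingMemory C ω Λ) :
    ScaleShiftRate (c + C * γ * ω) (max θ ω) γ β := by
  intro k w hw
  have hlim : |β (k + 1) w - β k (Fin.tail w)| ≤ c * θ ^ k + C * γ * ω ^ (k + 1) := by
    refine le_of_forall_pos_le_add fun η hη => ?_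
    obtain ⟨ε, hε0, hεγ, hcorner⟩ := hβ0 k (Fin.tail w) (tail_mem_box hw) η hη
    have hslide := abs_sub_cons_le hL hΛ hC hω0 hw hε0 hεγ
    calc |β (k + 1) w - β k (Fin.tail w)|
        = |(β (k + 1) w - β (k + 1) (Fin.cons ε (Fin.tail w))) + (β (k + 1) (Fin.cons ε (Fin.tail w)) - β k (Fin.tail w))| := by
          ring_nf
      _ ≤ |β (k + 1) w - β (k + 1) (Fin.cons ε (Fin.tail w))| + |β (k + 1) (Fin.cons ε (Fin.tail w)) - β k (Fin.tail w)| :=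
          abs_add_le _ _
      _ ≤ C * γ * ω ^ (k + 1) + (c * θ ^ k + η) := add_le_add hslide hcorner
      _ = c * θ ^ k + C * γ * ω ^ (k + 1) + η := by ring
  have hθk : θ ^ k ≤ (max θ ω) ^ k := pow_le_pow_left₀ hθ0 (le_max_left _ _) k
  have hωk : ω ^ (k + 1) ≤ ω * (max θ ω) ^ k := by
    rw [pow_succ']
    exact mul_le_mul_of_nonneg_left (pow_le_pow_left₀ hω0 (le_max_right _ _) k) hω0
  calc |β (k + 1) w - β k (Fin.tail w)| ≤ c * θ ^ k + C * γ * ω ^ (k + 1) := hlim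
    _ ≤ c * (max θ ω) ^ k + C * γ * (ω * (max θ ω) ^ k) :=
        add_le_add (mul_le_mul_of_nonneg_left hθk hc) (mul_le_mul_of_nonneg_left hωk (by positivity))
    _ = (c + C * γ * ω) * (max θ ω) ^ k := by ring

/-! ## §2 The converse (trivial): NE4 gives the corner form -/

/-- `ScaleShiftRate c θ γ β` gives the corner hypothesis of §1 with `η` unused and `ε = γ` (or any bare coupling in `]0,γ]`): for every
tail `v ∈ ]0,γ]^{k+1}`, `|β_{k+2}(γ, v) − β_{k+1}(v)| ≤ c·θ^k`. [folklore] -/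
theorem bareCorner_of_scaleShiftRate {β : HBeta} {γ c θ : ℝ} (hγ : 0 < γ) (hS : ScaleShiftRate c θ γ β) :
    ∀ k (v : Fin (k + 1) → ℝ), v ∈ Box γ k → ∀ η : ℝ, 0 < η →
      ∃ ε : ℝ, 0 < ε ∧ ε ≤ γ ∧ |β (k + 1) (Fin.cons ε v) - β k v| ≤ c * θ ^ k + η := by
  intro k v hv η hη
  refine ⟨γ, hγ, le_rfl, ?_⟩
  have h := hS k (Fin.cons γ v) (cons_mem_box hγ le_rfl hv)
  rw [Fin.tail_cons] at h
  linarith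

/-! ## §3 The quantitative instance: a bare-coupling remnant of any positive order is absent -/

/-- **A REMNANT SIZED BY THE BARE COUPLING IS NO WEAKENING OF NE4** (given the memory companion): if ON THE BOX
`|β_{k+2}(w) − β_{k+1}(Fin.tail w)| ≤ c·θ^k + R·(w 0)^κ` with `κ > 0`, `R ≥ 0`, and `HistLipschitz Λ γ β`, `FadingMemory C ω Λ`, then
`ScaleShiftRate (c + C·γ·ω) (max θ ω) γ β` (§1 with `ε` so small that `R·ε^κ ≤ η`).  The same statement as
`Spine/NE4/ScaleShiftRemnant.lean`'s `scaleShiftRate_of_bareRemnant_fadingMemory`, derived here from the corner form. [folklore] -/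
theorem scaleShiftRate_of_bareRemnant {β : HBeta} {γ c θ R κ C ω : ℝ} {Λ : ℕ → ℕ → ℝ}
    (hγ : 0 < γ) (hc : 0 ≤ c) (hθ0 : 0 ≤ θ) (hR : 0 ≤ R) (hκ : 0 < κ) (hC : 0 ≤ C) (hω0 : 0 ≤ ω)
    (hβ : ∀ k (w : Fin (k + 2) → ℝ), w ∈ Box γ (k + 1) → |β (k + 1) w - β k (Fin.tail w)| ≤ c * θ ^ k + R * (w 0) ^ κ)
    (hL : HistLipschitz Λ γ β) (hΛ : FadingMemory C ω Λ) :
    ScaleShiftRate (c + C * γ * ω) (max θ ω) γ β := by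
  refine scaleShiftRate_of_bareCorner hγ hc hθ0 hC hω0 (fun k v hv η hη => ?_) hL hΛ
  -- choose `ε = min γ ((η∕(R+1))^{1∕κ})`
  set η' : ℝ := η / (R + 1) with hη'def
  have hη' : 0 < η' := by positivity
  refine ⟨min γ (η' ^ κ⁻¹), lt_min hγ (Real.rpow_pos_of_pos hη' _), min_le_left _ _, ?_⟩
  have hε0 : 0 < min γ (η' ^ κ⁻¹) := lt_min hγ (Real.rpow_pos_of_pos hη' _)
  have hεκ : (min γ (η' ^ κ⁻¹)) ^ κ ≤ η' := by
    calc (min γ (η' ^ κ⁻¹)) ^ κ ≤ (η' ^ κ⁻¹) ^ κ := Real.rpow_le_rpow hε0.le (min_le_right _ _) hκ.le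
      _ = η' := Real.rpow_inv_rpow hη'.le hκ.ne'
  have hRε : R * (min γ (η' ^ κ⁻¹)) ^ κ ≤ η := by
    calc R * (min γ (η' ^ κ⁻¹)) ^ κ ≤ R * η' := mul_le_mul_of_nonneg_left hεκ hR
      _ ≤ (R + 1) * η' := mul_le_mul_of_nonneg_right (by linarith) hη'.le
      _ = η := by rw [hη'def]; field_simp
  have h := hβ k (Fin.cons (min γ (η' ^ κ⁻¹)) v) (cons_mem_box hε0 (min_le_left _ _) hv)
  rw [Fin.tail_cons, Fin.cons_zero] at h
  linarith

/-! ## §4 (v1.1) The memory companion is NECESSARY for the reduction: the running-maximum family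

Without `FadingMemory` the corner form of §1 does NOT give NE4.  Witness (an `abbrev`-free lambda in the statements; this docstring names
it): the RUNNING-MAXIMUM family `βmax k w = b + A·max_{i ≤ k} w_i` (`Finset.univ.sup'`).  Prepending a bare coupling `ε ≤ max v` to a tail `v`
does not change the maximum, so the corner form holds with `c = 0` EXACTLY (`cornerMax_corner`); the family is history-Lipschitz with the
CONSTANT moduli `Λ k i = A` (`cornerMax_histLipschitz`), which are not fading for any `C` once `A > 0`, `ω < 1` (`const_not_fadingMemory`);
and NE4 fails for every `c` and every `θ < 1` (`cornerMax_not_scaleShiftRate`: at `w = (γ, γ∕2, …, γ∕2)` the two-depth shift is `A·γ∕2` at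
every scale).  So in `scaleShiftRate_of_bareCorner` the memory companion cannot be dropped.  MODEL family, nothing of Bałaban's. -/

/-- The maximum is unchanged by prepending a value not exceeding it: `max(ε, v_0, …, v_k) = max(v_0, …, v_k)` for `ε ≤ max v`. [folklore] -/
theorem sup'_cons_eq_of_le {k : ℕ} (v : Fin (k + 1) → ℝ) {ε : ℝ} (hε : ε ≤ Finset.univ.sup' Finset.univ_nonempty v) :
    Finset.univ.sup' Finset.univ_nonempty (Fin.cons ε v : Fin (k + 2) → ℝ) = Finset.univ.sup' Finset.univ_nonempty v := by
  refine le_antisymm ?_ ?_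
  · refine Finset.sup'_le _ _ fun i _ => ?_
    refine Fin.cases ?_ (fun j => ?_) i
    · simpa using hε
    · simpa using Finset.le_sup' v (Finset.mem_univ j)
  · refine Finset.sup'_le _ _ fun j _ => ?_
    have h := Finset.le_sup' (Fin.cons ε v : Fin (k + 2) → ℝ) (Finset.mem_univ j.succ)
    simpa using h

/-- The maximum of `(γ, γ∕2, …, γ∕2)` is `γ` (`γ ≥ 0`). [folklore] -/
theorem sup'_cons_half {k : ℕ} {γ : ℝ} (hγ : 0 ≤ γ) :
    Finset.univ.sup' Finset.univ_nonempty (Fin.cons γ (fun _ : Fin (k + 1) => γ / 2) : Fin (k + 2) → ℝ) = γ := by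
  refine le_antisymm ?_ ?_
  · refine Finset.sup'_le _ _ fun i _ => ?_
    refine Fin.cases ?_ (fun j => ?_) i
    · simp
    · simp only [Fin.cons_succ]; linarith
  · have h := Finset.le_sup' (Fin.cons γ (fun _ : Fin (k + 1) => γ / 2) : Fin (k + 2) → ℝ) (Finset.mem_univ 0)
    simpa using h

/-- The maximum is 1-Lipschitz for the ℓ¹ distance: `|max p − max q| ≤ Σ_i |p_i − q_i|`. [folklore] -/
theorem abs_sup'_sub_sup'_le {k : ℕ} (p q : Fin (k + 1) → ℝ) :
    |Finset.univ.sup' Finset.univ_nonempty p - Finset.univ.sup' Finset.univ_nonempty q| ≤ ∑ i : Fin (k + 1), |p i - q i| := by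
  have key : ∀ (p q : Fin (k + 1) → ℝ),
      Finset.univ.sup' Finset.univ_nonempty p ≤ Finset.univ.sup' Finset.univ_nonempty q + ∑ i : Fin (k + 1), |p i - q i| := by
    intro p q
    refine Finset.sup'_le _ _ fun i _ => ?_
    have h1 : p i ≤ q i + |p i - q i| := by linarith [le_abs_self (p i - q i)]
    have h2 : q i ≤ Finset.univ.sup' Finset.univ_nonempty q := Finset.le_sup' q (Finset.mem_univ i)
    have h3 : |p i - q i| ≤ ∑ j : Fin (k + 1), |p j - q j| :=
      Finset.single_le_sum (f := fun j => |p j - q j|) (fun j _ => abs_nonneg _) (Finset.mem_univ i)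
    linarith
  have hpq := key p q
  have hqp := key q p
  have hsymm : ∑ i : Fin (k + 1), |q i - p i| = ∑ i : Fin (k + 1), |p i - q i| :=
    Finset.sum_congr rfl fun i _ => abs_sub_comm _ _
  rw [hsymm] at hqp
  rw [abs_sub_le_iff]; constructor <;> linarith

/-- THE CORNER FORM HOLDS EXACTLY for the running-maximum family: for every tail `v ∈ ]0,γ]^{k+1}` the bare coupling `ε = v_0 ≤ max v`
gives `βmax_{k+2}(ε, v) − βmax_{k+1}(v) = 0`, so §1's hypothesis holds with `c = 0` (any `θ`, any `η > 0`). [folklore] -/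
theorem cornerMax_corner {γ b A θ : ℝ} :
    ∀ k (v : Fin (k + 1) → ℝ), v ∈ Box γ k → ∀ η : ℝ, 0 < η → ∃ ε : ℝ, 0 < ε ∧ ε ≤ γ ∧
      |(fun (k : ℕ) (w : Fin (k + 1) → ℝ) => b + A * Finset.univ.sup' Finset.univ_nonempty w) (k + 1) (Fin.cons ε v)
        - (fun (k : ℕ) (w : Fin (k + 1) → ℝ) => b + A * Finset.univ.sup' Finset.univ_nonempty w) k v| ≤ 0 * θ ^ k + η := by
  intro k v hv η hη
  have hv0 := (mem_box.mp hv) 0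
  refine ⟨v 0, hv0.1, hv0.2, ?_⟩
  have hle : v 0 ≤ Finset.univ.sup' Finset.univ_nonempty v := Finset.le_sup' v (Finset.mem_univ 0)
  simp only [sup'_cons_eq_of_le v hle, sub_self, abs_zero, zero_mul, zero_add]
  exact hη.le

/-- The running-maximum family is history-Lipschitz with the CONSTANT moduli `Λ k i = A` (`A ≥ 0`). [folklore] -/
theorem cornerMax_histLipschitz {γ b A : ℝ} (hA : 0 ≤ A) :
    HistLipschitz (fun _ _ => A) γ (fun (k : ℕ) (w : Fin (k + 1) → ℝ) => b + A * Finset.univ.sup' Finset.univ_nonempty w) := by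
  intro k p q _ _
  have h := abs_sup'_sub_sup'_le p q
  calc |b + A * Finset.univ.sup' Finset.univ_nonempty p - (b + A * Finset.univ.sup' Finset.univ_nonempty q)|
      = A * |Finset.univ.sup' Finset.univ_nonempty p - Finset.univ.sup' Finset.univ_nonempty q| := by
        rw [show b + A * Finset.univ.sup' Finset.univ_nonempty p - (b + A * Finset.univ.sup' Finset.univ_nonempty q)
            = A * (Finset.univ.sup' Finset.univ_nonempty p - Finset.univ.sup' Finset.univ_nonempty q) by ring, abs_mul, abs_of_nonneg hA]
    _ ≤ A * ∑ i : Fin (k + 1), |p i - q i| := mul_le_mul_of_nonneg_left h hA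
    _ = ∑ i : Fin (k + 1), A * |p i - q i| := by rw [Finset.mul_sum]

/-- CONSTANT POSITIVE MODULI ARE NOT FADING: `FadingMemory C ω (fun _ _ => A)` fails for every `C` when `A > 0`, `ω < 1` (at `i = 0`, `A ≤ C·ω^k`
for all `k` forces `A ≤ 0`). [folklore] -/
theorem const_not_fadingMemory {A C ω : ℝ} (hA : 0 < A) (hω1 : ω < 1) : ¬ FadingMemory C ω (fun _ _ => A) := by
  intro h
  by_cases hC : C ≤ 0
  · have h0 := (h 0 0 le_rfl).2
    simp at h0
    linarith
  · push Not at hC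
    obtain ⟨n, hn⟩ := exists_pow_lt_of_lt_one (div_pos hA hC) hω1
    have h1 := (h n 0 (Nat.zero_le n)).2
    rw [Nat.sub_zero] at h1
    have : C * ω ^ n < A := by
      calc C * ω ^ n < C * (A / C) := mul_lt_mul_of_pos_left hn hC
        _ = A := by field_simp
    linarith

/-- **NE4 FAILS FOR THE RUNNING-MAXIMUM FAMILY** (`A > 0`, `γ > 0`): for every `c` and every `θ < 1`, `¬ ScaleShiftRate c θ γ βmax` — at the
history `(γ, γ∕2, …, γ∕2)` of any length the two-depth shift is `A·γ∕2`, which no `c·θ^k` dominates for all `k`.  With `cornerMax_corner` and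
`cornerMax_histLipschitz` ∕ `const_not_fadingMemory`: the corner form + history-Lipschitz moduli WITHOUT fading memory do not give NE4 — the
memory companion in `scaleShiftRate_of_bareCorner` is necessary. [folklore] -/
theorem cornerMax_not_scaleShiftRate {γ b A c θ : ℝ} (hA : 0 < A) (hγ : 0 < γ) (hθ1 : θ < 1) :
    ¬ ScaleShiftRate c θ γ (fun (k : ℕ) (w : Fin (k + 1) → ℝ) => b + A * Finset.univ.sup' Finset.univ_nonempty w) := by
  intro hS
  -- the shift at `(γ, γ∕2, …, γ∕2)` is `A·γ∕2` at every scale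
  have hshift : ∀ k, A * γ / 2 ≤ c * θ ^ k := by
    intro k
    have hw : (Fin.cons γ (fun _ : Fin (k + 1) => γ / 2) : Fin (k + 2) → ℝ) ∈ Box γ (k + 1) :=
      cons_mem_box hγ le_rfl (mem_box.mpr fun _ => ⟨by linarith, by linarith⟩)
    have h := hS k _ hw
    simp only [Fin.tail_cons] at h
    rw [sup'_cons_half hγ.le, Finset.sup'_const] at h
    have e : b + A * γ - (b + A * (γ / 2)) = A * γ / 2 := by ring
    rw [e, abs_of_pos (by positivity)] at h
    exact h
  have hpos : 0 < A * γ / 2 := by positivity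
  by_cases hc : c ≤ 0
  · have := hshift 0
    have : c * θ ^ 0 ≤ 0 := by simpa using hc
    linarith
  · push Not at hc
    obtain ⟨n, hn⟩ := exists_pow_lt_of_lt_one (div_pos hpos hc) hθ1
    have : c * θ ^ n < A * γ / 2 := by
      calc c * θ ^ n < c * (A * γ / 2 / c) := mul_lt_mul_of_pos_left hn hc
        _ = A * γ / 2 := by field_simp
    linarith [hshift n]

/-! ## §5 (v1.2) Only the BARE coupling's column of the moduli is used — general envelopes

The reduction of §1 uses the memory companion only through ONE column of the history moduli: the influence `Λ (k+1) 0` of the OLDEST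
coupling on `β_{k+2}`.  Stated with that column alone and with arbitrary envelopes: if NE4's two-depth bound holds at the asymptotically free
corner with envelope `e k` and the bare coupling's influence is at most `φ (k+1)`, then ON THE BOX the two-depth shift is at most
`e k + γ·φ(k+1)` — geometric envelopes give `ScaleShiftRate` (§1 with the weaker hypothesis), summable ones give a summable box envelope (the
currency of the ℓ¹ road, `NE7MarginalL1Supply`, and of King's route with summable memory, `Spine/NE4/KingCurrencySummable.lean`). -/

/-- THE SLIDE, ONE COLUMN: under `HistLipschitz Λ γ β`, if the bare coupling's modulus at depth `k+2` satisfies `0 ≤ Λ (k+1) 0 ≤ φ₀`, two histories in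
the box with the same tail differ in `β_{k+2}` by at most `φ₀·γ`. [cite: Balaban1987RG1, §5 p.298] -/
theorem abs_sub_cons_le_of_column {β : HBeta} {γ φ₀ : ℝ} {Λ : ℕ → ℕ → ℝ} {k : ℕ} {w : Fin (k + 2) → ℝ} {ε : ℝ}
    (hL : HistLipschitz Λ γ β) (hcol : 0 ≤ Λ (k + 1) 0 ∧ Λ (k + 1) 0 ≤ φ₀)
    (hw : w ∈ Box γ (k + 1)) (hε0 : 0 < ε) (hεγ : ε ≤ γ) :
    |β (k + 1) w - β (k + 1) (Fin.cons ε (Fin.tail w))| ≤ φ₀ * γ := by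
  have hwi := mem_box.mp hw
  have hw' : (Fin.cons ε (Fin.tail w) : Fin (k + 2) → ℝ) ∈ Box γ (k + 1) := cons_mem_box hε0 hεγ (tail_mem_box hw)
  have hLk := hL (k + 1) w (Fin.cons ε (Fin.tail w)) hw hw'
  have hsum : ∑ i : Fin (k + 2), Λ (k + 1) i * |w i - (Fin.cons ε (Fin.tail w) : Fin (k + 2) → ℝ) i|
      = Λ (k + 1) 0 * |w 0 - ε| := by
    rw [Fin.sum_univ_succ]
    have hrest : ∑ i : Fin (k + 1), Λ (k + 1) i.succ * |w i.succ - (Fin.cons ε (Fin.tail w) : Fin (k + 2) → ℝ) i.succ| = 0 := by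
      refine Finset.sum_eq_zero fun i _ => ?_
      rw [Fin.cons_succ, Fin.tail, sub_self, abs_zero, mul_zero]
    rw [hrest, add_zero, Fin.cons_zero]
    simp
  rw [hsum] at hLk
  have hdist : |w 0 - ε| ≤ γ := by
    rw [abs_sub_le_iff]; constructor <;> linarith [(hwi 0).1, (hwi 0).2]
  calc |β (k + 1) w - β (k + 1) (Fin.cons ε (Fin.tail w))| ≤ Λ (k + 1) 0 * |w 0 - ε| := hLk
    _ ≤ φ₀ * γ := mul_le_mul hcol.2 hdist (abs_nonneg _) (hcol.1.trans hcol.2)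

/-- **GENERAL ENVELOPES, ONE COLUMN.**  If for every `k`, every tail `v ∈ ]0,γ]^{k+1}` and every `η > 0` some bare coupling `ε ∈ ]0,γ]` has
`|β_{k+2}(ε, v) − β_{k+1}(v)| ≤ e_k + η` (NE4's comparison at the asymptotically free corner, with ANY envelope `e`), and the bare coupling's influence on
`β_{k+2}` is bounded by `φ(k+1)` (`0 ≤ Λ (k+1) 0 ≤ φ (k+1)`, ONE column of `HistLipschitz`'s moduli — no condition on the other columns), then ON THE
WHOLE BOX `|β_{k+2}(w) − β_{k+1}(Fin.tail w)| ≤ e_k + γ·φ(k+1)`. [folklore] -/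
theorem shiftEnvelope_of_bareCorner_column {β : HBeta} {γ : ℝ} {e φ : ℕ → ℝ} {Λ : ℕ → ℕ → ℝ}
    (hβ0 : ∀ k (v : Fin (k + 1) → ℝ), v ∈ Box γ k → ∀ η : ℝ, 0 < η →
      ∃ ε : ℝ, 0 < ε ∧ ε ≤ γ ∧ |β (k + 1) (Fin.cons ε v) - β k v| ≤ e k + η)
    (hL : HistLipschitz Λ γ β) (hcol : ∀ k, 0 ≤ Λ (k + 1) 0 ∧ Λ (k + 1) 0 ≤ φ (k + 1)) :
    ∀ k (w : Fin (k + 2) → ℝ), w ∈ Box γ (k + 1) → |β (k + 1) w - β k (Fin.tail w)| ≤ e k + γ * φ (k + 1) := by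
  intro k w hw
  refine le_of_forall_pos_le_add fun η hη => ?_
  obtain ⟨ε, hε0, hεγ, hcorner⟩ := hβ0 k (Fin.tail w) (tail_mem_box hw) η hη
  have hslide := abs_sub_cons_le_of_column hL (hcol k) hw hε0 hεγ
  calc |β (k + 1) w - β k (Fin.tail w)|
      = |(β (k + 1) w - β (k + 1) (Fin.cons ε (Fin.tail w))) + (β (k + 1) (Fin.cons ε (Fin.tail w)) - β k (Fin.tail w))| := by
        ring_nf
    _ ≤ |β (k + 1) w - β (k + 1) (Fin.cons ε (Fin.tail w))| + |β (k + 1) (Fin.cons ε (Fin.tail w)) - β k (Fin.tail w)| :=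
        abs_add_le _ _
    _ ≤ φ (k + 1) * γ + (e k + η) := add_le_add hslide hcorner
    _ = e k + γ * φ (k + 1) + η := by ring

/-- **§1 WITH THE ONE-COLUMN HYPOTHESIS**: NE4 at the asymptotically free corner (envelope `c·θ^k`) + a geometric bound `Λ (k+1) 0 ≤ C·ω^{k+1}` on the
bare coupling's influence ALONE ⇒ `ScaleShiftRate (c + C·γ·ω) (max θ ω) γ β` (`c, θ, C, ω ≥ 0`, `γ > 0`).  `FadingMemory C ω Λ` is the special case where
every column fades. [folklore] -/
theorem scaleShiftRate_of_bareCorner_column {β : HBeta} {γ c θ C ω : ℝ} {Λ : ℕ → ℕ → ℝ}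
    (hγ : 0 < γ) (hc : 0 ≤ c) (hθ0 : 0 ≤ θ) (hC : 0 ≤ C) (hω0 : 0 ≤ ω)
    (hβ0 : ∀ k (v : Fin (k + 1) → ℝ), v ∈ Box γ k → ∀ η : ℝ, 0 < η →
      ∃ ε : ℝ, 0 < ε ∧ ε ≤ γ ∧ |β (k + 1) (Fin.cons ε v) - β k v| ≤ c * θ ^ k + η)
    (hL : HistLipschitz Λ γ β) (hcol : ∀ k, 0 ≤ Λ (k + 1) 0 ∧ Λ (k + 1) 0 ≤ C * ω ^ (k + 1)) :
    ScaleShiftRate (c + C * γ * ω) (max θ ω) γ β := by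
  intro k w hw
  have h := shiftEnvelope_of_bareCorner_column (e := fun k => c * θ ^ k) (φ := fun k => C * ω ^ k) hβ0 hL hcol k w hw
  have hθk : θ ^ k ≤ (max θ ω) ^ k := pow_le_pow_left₀ hθ0 (le_max_left _ _) k
  have hωk : ω ^ (k + 1) ≤ ω * (max θ ω) ^ k := by
    rw [pow_succ']
    exact mul_le_mul_of_nonneg_left (pow_le_pow_left₀ hω0 (le_max_right _ _) k) hω0
  calc |β (k + 1) w - β k (Fin.tail w)| ≤ c * θ ^ k + γ * (C * ω ^ (k + 1)) := h
    _ ≤ c * (max θ ω) ^ k + γ * (C * (ω * (max θ ω) ^ k)) :=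
        add_le_add (mul_le_mul_of_nonneg_left hθk hc)
          (mul_le_mul_of_nonneg_left (mul_le_mul_of_nonneg_left hωk hC) hγ.le)
    _ = (c + C * γ * ω) * (max θ ω) ^ k := by ring

/-- **THE ℓ¹ CURRENCY**: a SUMMABLE corner envelope `e` and a SUMMABLE bound `φ` on the bare coupling's influence give the summable BOX envelope
`σ_k = e_k + γ·φ(k+1)` for the two-depth shift — the supplier shape of the ℓ¹ road (`NE7MarginalL1Supply`: any summable box envelope feeds
`ShiftAlongRun` along every run) and of King's route with summable memory. [folklore] -/
theorem summable_shiftEnvelope_of_bareCorner_column {β : HBeta} {γ : ℝ} {e φ : ℕ → ℝ} {Λ : ℕ → ℕ → ℝ}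
    (hβ0 : ∀ k (v : Fin (k + 1) → ℝ), v ∈ Box γ k → ∀ η : ℝ, 0 < η →
      ∃ ε : ℝ, 0 < ε ∧ ε ≤ γ ∧ |β (k + 1) (Fin.cons ε v) - β k v| ≤ e k + η)
    (hL : HistLipschitz Λ γ β) (hcol : ∀ k, 0 ≤ Λ (k + 1) 0 ∧ Λ (k + 1) 0 ≤ φ (k + 1))
    (he : Summable e) (hφ : Summable φ) :
    (∀ k (w : Fin (k + 2) → ℝ), w ∈ Box γ (k + 1) → |β (k + 1) w - β k (Fin.tail w)| ≤ e k + γ * φ (k + 1)) ∧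
    Summable (fun k => e k + γ * φ (k + 1)) :=
  ⟨shiftEnvelope_of_bareCorner_column hβ0 hL hcol,
    he.add (((summable_nat_add_iff 1).mpr hφ).mul_left γ)⟩

end Summit.QuantumFields.BalabanUV.T4Continuum.Spine.NE4.ScaleShiftBareCorner

end
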